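import Summits.BirchSwinnertonDyer.BirchSwinnertonDyer.Theses.DefiniteGrossPeriodAtTwo
import Summits.BirchSwinnertonDyer.Rank1Residual.Supersingular.SignedRankZero
import Literature.NumberTheory.EllipticCurves.NonEisensteinPrimeOfSurjective
import Literature.NumberTheory.EllipticCurves.AnalyticRankOrderProofs
import Literature.NumberTheory.EllipticCurves.BSDRootNumberSmallConductorProofs
import HarnessLib

/-!
# SKELETON LINE `signed_kato_cells` for crux 22972 `SupersingularKatoBoundAtTwoBigImage` (route DefiniteGrossPeriodAtTwo, r403)

line-writer skeleton (linewriter-bsd-wide-1 g0); NOT leaf progress. The supersingular-at-2 big-image CELL of the Kato bound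
(`Finite Ш[2^∞] ∧ ord₂ #Ш(E)[2^∞] ≤ ord₂ #Ш_an(E)` for non-CM E of analytic rank 0, ρ̄_{E,2} surjective, −Δ non-square, good
supersingular at 2, i.e. a₂ ∈ {0, ±2}) FOLLOWS from a SIGNED KATO PACKAGE at 2 — a signed Iwasawa datum D = (ξ^ε, L^ε, c) over
Λ = ℤ₂⟦T⟧ (the tree's hypothesis structure `Supersingular.SignedDatum W 2`) carrying (K) the signed Euler-characteristic reading
in rank 0, (P) the interpolation L^ε(0) = c·L(E,1)/Ω with 2 ∤ c, and (MC↑) the KATO-SIDE divisibility ξ^ε ∣ L^ε — split by the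
TRACE at 2: stub 1 the a₂ = 0 cell (Kobayashi ± condition, ♯ = +, ♭ = −; ι-symmetric), stub 2 the a₂ = ±2 cell (Sprung's ♯/♭
Coleman maps genuinely needed; the ♭-function's value law carries the extra 2, lens-1 9b); stub 3 the printed inputs (GZK,
modularity). Composition PROVED: irreducibility of E[2] from surjectivity (`hasIrreducibleModPGaloisRep_of_hasSurjectiveModNGaloisRep`),
L(E,1) ≠ 0 from analytic rank 0 (`analyticRank_eq_zero_iff_holds`), the tree's bookkeeping
`Supersingular.missingUpperBoundAt_of_signedUpperDivisibility` (Miller currency), then GZK finiteness of Ш(E) and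
`padicValNat_card_addPrimaryComponent` into the parent's 2-primary currency — the same reader as the pen's Ord/Mult cell
skeletons (line12c). Why this cut: at p = 2 the signed objects EXIST in print (Sprung 2012 JNT 132 p. 1486: ♯/♭ Coleman maps and
signed Selmer groups at p = 2) but (K), (P)-integrality and the Kato-side divisibility are printed for odd p only (Kobayashi 2003
Thm 4.1, B.D. Kim 2013, Sprung 2017) — the two stubs are exactly the beyond-print inputs, per trace. Big image is where Kato's
divisibility is INTEGRAL (no ϖ-power ambiguity: Kato 2004 Thm 17.4 (2) shape), which is why the cell carries ρ̄₂ surjective.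
Sorries ONLY inside `stub_*`; nothing asserted; no summit is proved.
-/

set_option autoImplicit false

namespace Summit.BirchSwinnertonDyer.BirchSwinnertonDyer.Cruxes.SupersingularKatoBoundAtTwoBigImage.SignedKatoCells

open WeierstrassCurve Literature.NumberTheory.EllipticCurves Literature.NumberTheory.EllipticCurves.Rank1Residual
  Literature.NumberTheory.EllipticCurves.Rank1Residual.Typed Summit.BirchSwinnertonDyer.Rank1Residual
  Summit.BirchSwinnertonDyer.Rank1Residual.Supersingular

/-- [research] stub 1 (a₂ = 0 cell): the ± SIGNED KATO PACKAGE at 2 under big image — a signed datum with (K), (P), 2 ∤ c and the Kato-side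
divisibility ξ^± ∣ L^± in ℤ₂⟦T⟧. Beyond print at p = 2 (Kobayashi 2003 Thm 4.1 / Kim 2013 are odd-p). -/
theorem stub_signedKatoPackageAtTwo_traceZero : ∀ (W : WeierstrassCurve ℚ) [W.IsElliptic] [W.IsGloballyMinimal],
    ¬ W.HasCM → W.HasSurjectiveModNGaloisRep (2 : ℤ) → ¬ IsSquare (-(W.Δ)) → W.analyticRank = 0 →
    Literature.NumberTheory.EllipticCurves.Rank1Residual.GoodSS W 2 → W.frobeniusTrace 2 = 0 →
    ∃ D : SignedDatum W 2, ¬ 2 ∣ D.c ∧ D.EulerCharacteristic ∧ D.Interpolation ∧ D.UpperDivisibility := by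
  sorry

/-- [research] stub 2 (a₂ = ±2 cell): the ♯/♭ SIGNED KATO PACKAGE at 2 under big image — Sprung's ♯/♭ datum with (K), (P), 2 ∤ c and the
Kato-side divisibility ξ^♯♭ ∣ L^♯♭. Beyond print at p = 2 (Sprung 2012 constructs the objects at 2; divisibility/control odd-p). -/
theorem stub_signedKatoPackageAtTwo_traceTwo : ∀ (W : WeierstrassCurve ℚ) [W.IsElliptic] [W.IsGloballyMinimal],
    ¬ W.HasCM → W.HasSurjectiveModNGaloisRep (2 : ℤ) → ¬ IsSquare (-(W.Δ)) → W.analyticRank = 0 →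
    Literature.NumberTheory.EllipticCurves.Rank1Residual.GoodSS W 2 → W.frobeniusTrace 2 ≠ 0 →
    ∃ D : SignedDatum W 2, ¬ 2 ∣ D.c ∧ D.EulerCharacteristic ∧ D.Interpolation ∧ D.UpperDivisibility := by
  sorry

/-- [print: GrossZagier1986 Thm. I.6.3 + Kolyvagin1990Euler Thm. A (GZK); Wiles1995/BreuilConradDiamondTaylor2001 Thm. A (modularity)] stub 3 = the PRINTED inputs BY NAME: Gross–Zagier–Kolyvagin (rank = analytic rank ∧ Ш finite in analytic rank ≤ 1; item
19921 `MultPublishedInputsAtTwo` / 19149 conjunct) and modularity as an entire L-function (Wiles–BCDT; 19567 conjunct). -/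
theorem stub_printedInputsAtTwo : rank_eq_analyticRank_of_analyticRank_le_one ∧ WeierstrassCurve.hasEntireLFunction_rat := by
  sorry

/-- **Composition (kernel-checked, no binders): `SupersingularKatoBoundAtTwoBigImage`** = the route decl
`Theses.DefiniteGrossPeriodAtTwo.SupersingularKatoBoundAtTwoBigImage` (item 22972, LINE 12′ cell r403) BY NAME.
[cite: Kobayashi2003, Thm. 1.2, Thm. 4.1] [cite: Sprung2012, p. 1486] [cite: Kato2004Asterisque, Thm. 17.4] [cite: Miller2011LMS, Def. 1.1]
[cite: GrossZagier1986] [cite: Kolyvagin1990Euler] -/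
theorem SupersingularKatoBoundAtTwoBigImage_of :
    Summit.BirchSwinnertonDyer.BirchSwinnertonDyer.Theses.DefiniteGrossPeriodAtTwo.SupersingularKatoBoundAtTwoBigImage := by
  have h0 := stub_signedKatoPackageAtTwo_traceZero
  have h2 := stub_signedKatoPackageAtTwo_traceTwo
  obtain ⟨hGZK, hLfun⟩ := stub_printedInputsAtTwo
  intro W _ _ hcm hs hnsq hr hss
  have hirr : W.HasIrreducibleModPGaloisRep 2 :=
    Literature.NumberTheory.EllipticCurves.hasIrreducibleModPGaloisRep_of_hasSurjectiveModNGaloisRep W 2 hs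
  have hL : W.entireLFunction 1 ≠ 0 := (W.analyticRank_eq_zero_iff_holds (hLfun W)).mp hr
  obtain ⟨D, hc, hK, hP, hdiv⟩ : ∃ D : SignedDatum W 2, ¬ 2 ∣ D.c ∧ D.EulerCharacteristic ∧ D.Interpolation ∧
      D.UpperDivisibility := by
    by_cases ht : W.frobeniusTrace 2 = 0
    · exact h0 W hcm hs hnsq hr hss ht
    · exact h2 W hcm hs hnsq hr hss ht
  have hU : MissingUpperBoundAt W 2 :=
    missingUpperBoundAt_of_signedUpperDivisibility W 2 hGZK hirr hL D hc hK hP hdiv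
  haveI hfin : Finite W.sha := (hGZK W (by omega)).2
  refine ⟨Finite.of_injective _ Subtype.val_injective, ?_⟩
  obtain ⟨q, hq, hv⟩ := hU
  refine ⟨q, hq, ?_⟩
  rw [Literature.NumberTheory.EllipticCurves.padicValNat_card_addPrimaryComponent]
  simpa [WeierstrassCurve.shaOrder] using hv

end Summit.BirchSwinnertonDyer.BirchSwinnertonDyer.Cruxes.SupersingularKatoBoundAtTwoBigImage.SignedKatoCells
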